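import Summits.QuantumFields.YangMills.Theorems.SelfNormalisedSkewness.Negative.TreeLevelSkewnessVanishes
import HarnessLib

/-!
# Route `BoundedSkewnessRunning`: the MASSIVE Gaussian foil — in `d = 4` the skewness of a Gaussian
# `tr F²` is carried entirely by the mass (trace) part of the propagator Hessian, and is sign-definite
# (strictly negative) on collinear configurations of any gapped Gaussian 2-form

Planner artefact (tribunal-w ∕ bc5-witness seat `ym-bc5-19897-1`, successor g1, 2026-08-27) for the two cruxes
of the REFUTATION route `BoundedSkewnessRunning` (`closes : K1 → K2 → S1 → S2 → S3 → ¬ YangMills`):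
K1 = `UVSkewnessExtinction` (stmt-QuantumFields-19897, BC5 rung landed: `uvSkewnessExtinction_rung_su2Triangle`,
p530765 — the free-gluon triangle of `d = 4` vanishes identically) and the deciding crux
K2 = `SkewnessNonGeneration` (stmt-QuantumFields-19896: along a weakly coupled `SU(2)` scheme with a
volume-uniform LATTICE MASS GAP and an RP window, UV extinction of the self-normalised skewness `κ₃ᶜᵃⁿ` of
`tr F²` along a companion scheme forces `κ₃ᶜᵃⁿ → 0` at the gapped scale too).  The route header stakes K2 on
«Gaussian domination pinned by gap + RP window» and «the φ⁴₄ Gaussian fate transplanted to the composite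
`tr F²`» (Theses/BoundedSkewnessRunning.lean, BARRIERS `UVStabilityNonUniqueness`, `ScalarPhi4Triviality`), and
its own why-might-fail line for K2 says «a gap alone breaks the self-dual cancellation that makes the free odd
ring vanish».  The judge's T3 finding (verdict-BoundedSkewnessRunning-tribunal-j, `what_would_move_it`) asks for
«a K2-analogue in ANY gapped model».  This file TYPES the gapped Gaussian model and decides the K2-analogue
there: it is FALSE, quantitatively and sign-definitely.

## The identity (§2)

`K h` (landed, `TreeLevelSkewnessVanishes`) is the plane–plane covariance `⟨F_{μν}(x)F_{ρσ}(0)⟩` of the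
curvature `F = dA` of a Gaussian vector field with `⟨A_νA_σ⟩ = δ_{νσ}D`, `h = ∇∇D(x)`; for the free MASSIVE
(Proca) field the longitudinal part `∂∂/m²` of the propagator drops out of `F = dA`, so the same `K(∇∇D_m)` is
its field-strength covariance, and likewise for any Källén–Lehmann superposition `D = ∫ D_μ dρ(μ²)` of a
`dA`-type 2-form [folklore].  `K` is linear, `K(𝟙) = −2·𝟙_{Λ²}` (`K_one`), `tr K(h) = −3 tr h` (`trace_K`),
and splitting `h = h⁰ + (tr h/4)𝟙` into its traceless part `h⁰ = tracelessPart h` and its trace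
`tr h = ΔD(x)` gives `K h = K h⁰ − (tr h/2)·𝟙` (`K_eq_tracelessPart`).  Since each `K hᵢ⁰` anticommutes with the
Hodge star (landed `K_anticomm'`), every odd word in the `K hᵢ⁰` is traceless, and expanding the product:

  `tr K(h₁)K(h₂)K(h₃) = −½·[ΔD₃·tr K(h₁⁰)K(h₂⁰) + ΔD₂·tr K(h₁⁰)K(h₃⁰) + ΔD₁·tr K(h₂⁰)K(h₃⁰)] − ¾·ΔD₁ΔD₂ΔD₃`

(`massiveOddRing_eq`, all symmetric `hᵢ`, `ΔDᵢ := tr hᵢ`).  READING: in four dimensions the third cumulant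
density of the Wick square `F_{μν}F_{μν}` of a Gaussian 2-form — `8·tr K(h₁)K(h₂)K(h₃)` at separations
`x−y, y−z, z−x` — consists of MASS INSERTIONS ONLY: one Laplacian `ΔD = ∫μ²D_μ dρ` on one side of the triangle
times the EVEN two-ring of the other two sides, plus the triple insertion.  For the massless (harmonic,
GAPLESS) propagator every term vanishes (landed `treeLevelSkewness_vanishes`, `maxwellOddRing_eq_zero`,
`gluonOddRing_eq_zero`); a mass gap is exactly what turns the skewness on.

## Sign-definiteness on collinear configurations (§3, the foil proper)

For three collinear separations on the `e₀`-axis the Hessian of a radial kernel `D = φ(|x|²)` is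
`axisHess α γ = α𝟙 + γ e₀e₀ᵀ` (`α = 2φ'(t²)`, `γ = 4t²φ''(t²)`; `radialHess_axis`), `K(axisHess α γ)` is diagonal,
`−(2α+γ)` on the three electric planes and `−2α` on the three magnetic ones (`K_axisHess`), and

  `tr K₁K₂K₃ = −3·[(2α₁+γ₁)(2α₂+γ₂)(2α₃+γ₃) + 8α₁α₂α₃] = −3·[∏ᵢ(ΔDᵢ + uᵢ) − ∏ᵢ uᵢ]`,  `uᵢ = −2αᵢ = −4φ'`,

(`axisOddRing_eq`).  Hence (`axisOddRing_neg`, `radialOddRing_collinear_neg`): whenever the kernel is radially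
non-increasing (`φ' ≤ 0`, i.e. `αᵢ ≤ 0`) and strictly subharmonic at the three separations (`ΔDᵢ = 4αᵢ+γᵢ > 0`)
— which holds at EVERY `x ≠ 0` for the free massive propagator `D_m = (m/4π²|x|)K₁(m|x|)` (`ΔD_m = m²D_m > 0`,
`D_m` decreasing) and for every Källén–Lehmann superposition with non-zero mass content [folklore] — the odd
ring is STRICTLY NEGATIVE; it vanishes iff the kernel is harmonic there (`axisOddRing_eq_zero_of_harmonic`).
The even ring on the axis is `3(2α₁+γ₁)(2α₂+γ₂) + 12α₁α₂ > 0` under the same signs (`axisEvenRing_eq`,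
`axisEvenRing_pos`), so the self-normalisation `T^{3/2}` is finite and non-zero: by continuity of the kernel
off the diagonal, bumps `f, g, h ≥ 0` concentrated at three collinear points at mutual distance `≍ 1/m` have
Gaussian `κ₃(F²(f),F²(g),F²(h)) = 8∫∫∫ fgh·tr K K K < 0` with NO cancellation available, i.e. a self-normalised
skewness bounded away from `0` — of order one at the scale of the gap, and of relative order `(mℓ)²` at
separation `ℓ ≪ 1/m` (one mass insertion, first bracket of `massiveOddRing_eq`).  Smoke test: `tr K(𝟙)³ = −48`
(`trace_K_one_cube`).

## What this says about K2 and K1 (located objection; nothing is refuted in the tree)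

* K2's conclusion — `κ₃ᶜᵃⁿ(sch,u;f,g,h) → 0` for ALL disjoint compactly supported triples on a GAPPED scheme —
  FAILS in every Gaussian(-dominated) caricature that has the gap K2 assumes: the free massive vector field ∕
  any `dA`-type 2-form with Källén–Lehmann mass `≥ m > 0` has non-zero, sign-definite `tr F²`-skewness at
  collinear triples at scale `1/m`.  The ONLY Gaussian 2-form with vanishing `F²`-skewness is the massless
  Maxwell field, which has no gap.  So «Gaussian domination pinned by gap» predicts `¬`(K2's conclusion), not
  K2: for K2 to hold on an inhabited datum, the scale-`ξ` curvature correlations must be NON-Gaussian with a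
  connected three-point function that exactly cancels the Gaussian mass-insertion terms above — the opposite of
  the φ⁴₄ "Gaussian fate" the thesis transplants.  Together with the interacting consensus (triple-glueball
  coupling, the route's own why-might-fail; disprover's `Cruxes/SkewnessNonGeneration/Disproof.lean` item 4)
  this leaves NO known model, free or interacting, gapped as K2 requires, in which K2's conclusion holds.  In the
  language of `Theorems/SkewnessNonGeneration/Negative/CompanionFree.lean`: the expected inhabitant of
  `SkewedGappedScheme` is already visible at the Gaussian level.  (No unconditional kill: `HasLatticeMassGap`
  for `SU(2)` at `β → ∞` is not constructible — tribunal `carrier-unverified:SkewnessNonGeneration:binder:r`.)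
* K1 (UV window, separations `ℓ_k ≤ β_k^κ a_k ≪ ξ_k`): consistent and sharpened — in the caricature the
  skewness at separation `ℓ` is `O((ℓ/ξ)²)` relative (one mass insertion) on top of the `O(g²(ℓ))` loop
  corrections of the landed rung, and `(β^κ a/ξ)² → 0` along K1's schemes.  Skewness of `tr F²` in `d = 4` is
  an INFRARED effect; K1 removes the infrared, K2 puts it back.
* Correction to a remark in the K2 disprover's HANDOFF (iii) («massless Maxwell: skewness of `F²` … non-zero
  at fixed physical separation … so K1 itself would fail for `U(1)`»): in `d = 4` the massless `F²`-skewness is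
  identically zero (`maxwellOddRing_eq_zero`); the Gaussian toy in which non-generation FAILS is the GAPPED
  one, typed here.  (In `d = 3` the massless odd ring is non-zero — `maxwellOddRing3_ne_zero` of the K1 rung
  file — because `⋆ : Λ² → Λ²` needs `d = 4`.)

## §4 (companion file `MassiveGaussianFoilObstruction`) — the typed obstruction

The negative lemma modulo `H_m` («massive-Gaussian-dominated gapped scheme» `→ SkewedGappedScheme → ¬ K2`,
given K1) lives in the companion file, which imports the route's `CompanionFree` lemmas; this file is
route-independent (no `Theses` import) so that route edits do not rebuild it.

Contents. §1 `K_add`, `K_smul`, `K_sub`, `K_one`, `trace_K`, `trace_K_one_cube`, `tracelessPart` (+ `_trace`,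
`_isSymm`), `K_eq_tracelessPart`, `trace_K_tracelessPart`; §2 `trace_eq_zero_of_anticomm₁`,
`trace_triple_shift`, `massiveOddRing_eq`; §3 `P₀`, `axisHess` (+ `_isSymm`, `_trace`), `K_axisHess`,
`axisOddRing_eq`, `axisEvenRing_eq`, `axisOddRing_eq_zero_of_harmonic`, `axisOddRing_neg`, `axisEvenRing_pos`,
`normSq`, `axisVec`, `normSq_axisVec`, `radialHess` (+ `_trace`, `_axis`), `radialOddRing_collinear_neg`.  No `sorry`;
axioms `propext`,
`Classical.choice`, `Quot.sound`; finite-dimensional linear algebra only; HONEST FRAMING: a Gaussian-level (one-loop) foil and a located objection to K2's stated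
mechanism — K2 itself is untouched in the tree.  Sources: [folklore] (Wick's rule; Proca ∕ Källén–Lehmann
2-form covariances; `(−Δ+m²)D_m = δ`); MontvayMunster1994 §3.3 (lattice perturbation theory) for the
dictionary of the K1 rung this file extends.
-/

set_option autoImplicit false

noncomputable section

open scoped BigOperators
open Matrix
open Summit.QuantumFields.YangMills.Theorems.SelfNormalisedSkewness.Negative

namespace Summit.QuantumFields.YangMills.Theorems.SkewnessNonGeneration.Negative.MassiveGaussianFoil

/-! ## §1 Linear structure of `K` and the trace (mass) part -/

/-- `K` is additive. [folklore] -/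
theorem K_add (h h' : Matrix (Fin 4) (Fin 4) ℝ) : K (h + h') = K h + K h' := by
  ext i j
  simp only [K, Matrix.add_apply]
  ring

/-- `K` is homogeneous. [folklore] -/
theorem K_smul (c : ℝ) (h : Matrix (Fin 4) (Fin 4) ℝ) : K (c • h) = c • K h := by
  ext i j
  simp only [K, Matrix.smul_apply, smul_eq_mul]
  ring

/-- `K` respects differences. [folklore] -/
theorem K_sub (h h' : Matrix (Fin 4) (Fin 4) ℝ) : K (h - h') = K h - K h' := by
  ext i j
  simp only [K, Matrix.sub_apply]
  ring

/-- **The pure-trace (mass) insertion**: `K(𝟙) = −2·𝟙` on `Λ²ℝ⁴` — the Hessian direction `δ_{μρ}` (the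
Laplacian ∕ mass part `ΔD·𝟙/4` of a propagator Hessian) acts on 2-forms as a multiple of the identity, so it
COMMUTES with the Hodge star instead of anticommuting. [folklore] -/
theorem K_one : K (1 : Matrix (Fin 4) (Fin 4) ℝ) = (-2 : ℝ) • (1 : Matrix (Fin 6) (Fin 6) ℝ) := by
  ext i j
  fin_cases i <;> fin_cases j <;>
    simp +decide [K, p1, p2, δ, Matrix.one_apply, Matrix.smul_apply] <;> norm_num

/-- The plane-trace of `K h` is `−3 tr h` (each diagonal plane entry is `−h_{μμ} − h_{νν}`). [folklore] -/
theorem trace_K (h : Matrix (Fin 4) (Fin 4) ℝ) : (K h).trace = -3 * h.trace := by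
  simp +decide [Matrix.trace, Matrix.diag, Fin.sum_univ_succ, K, p1, p2, δ]
  ring

/-- Smoke test: three isotropic (pure-mass) insertions give the odd ring `tr K(𝟙)³ = −48 ≠ 0`. [folklore] -/
theorem trace_K_one_cube :
    (K (1 : Matrix (Fin 4) (Fin 4) ℝ) * K 1 * K 1).trace = -48 := by
  rw [K_one]
  simp [Matrix.trace_one, smul_smul]
  norm_num

/-- The traceless part `h⁰ = h − (tr h/4)·𝟙` of a `4 × 4` matrix. [folklore] -/
def tracelessPart (h : Matrix (Fin 4) (Fin 4) ℝ) : Matrix (Fin 4) (Fin 4) ℝ :=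
  h - (h.trace / 4) • (1 : Matrix (Fin 4) (Fin 4) ℝ)

/-- `h⁰` is traceless. [folklore] -/
theorem tracelessPart_trace (h : Matrix (Fin 4) (Fin 4) ℝ) : (tracelessPart h).trace = 0 := by
  simp [tracelessPart, Matrix.trace_sub, Matrix.trace_smul, Matrix.trace_one]

/-- `h⁰` is symmetric when `h` is. [folklore] -/
theorem tracelessPart_isSymm {h : Matrix (Fin 4) (Fin 4) ℝ} (hs : h.IsSymm) : (tracelessPart h).IsSymm :=
  hs.sub ((Matrix.isSymm_one).smul _)

/-- **Mass splitting of the covariance**: `K h = K h⁰ − (tr h/2)·𝟙`. [folklore] -/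
theorem K_eq_tracelessPart (h : Matrix (Fin 4) (Fin 4) ℝ) :
    K h = K (tracelessPart h) - (h.trace / 2) • (1 : Matrix (Fin 6) (Fin 6) ℝ) := by
  rw [tracelessPart, K_sub, K_smul, K_one, smul_smul]
  ext i j
  simp only [Matrix.sub_apply, Matrix.smul_apply, smul_eq_mul]
  ring

/-- `K h⁰` is traceless. [folklore] -/
theorem trace_K_tracelessPart (h : Matrix (Fin 4) (Fin 4) ℝ) : (K (tracelessPart h)).trace = 0 := by
  rw [trace_K, tracelessPart_trace, mul_zero]

/-! ## §2 The massive odd-ring identity: skewness = mass insertions -/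

/-- A matrix anticommuting with an involution is traceless: `tr A = tr(TAT) = −tr A`. [folklore] -/
theorem trace_eq_zero_of_anticomm₁ {n : Type*} [Fintype n] [DecidableEq n] {T A : Matrix n n ℝ}
    (hT : T * T = 1) (hA : A * T = -(T * A)) : A.trace = 0 := by
  have h1 : (T * A * T).trace = A.trace := by
    rw [Matrix.trace_mul_cycle, hT, Matrix.one_mul]
  have h2 : T * A * T = -A := by
    rw [Matrix.mul_assoc, hA, Matrix.mul_neg, ← Matrix.mul_assoc, hT, Matrix.one_mul]
  rw [h2, Matrix.trace_neg] at h1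
  linarith

/-- Expanding a product of three mass-shifted operators whose odd words are traceless. [folklore] -/
theorem trace_triple_shift {n : Type*} [Fintype n] [DecidableEq n] (O₁ O₂ O₃ : Matrix n n ℝ)
    (c₁ c₂ c₃ : ℝ) (h123 : (O₁ * O₂ * O₃).trace = 0) (h₁ : O₁.trace = 0) (h₂ : O₂.trace = 0)
    (h₃ : O₃.trace = 0) :
    ((O₁ - c₁ • (1 : Matrix n n ℝ)) * (O₂ - c₂ • (1 : Matrix n n ℝ)) *
        (O₃ - c₃ • (1 : Matrix n n ℝ))).trace =
      -(c₃ * (O₁ * O₂).trace + c₂ * (O₁ * O₃).trace + c₁ * (O₂ * O₃).trace)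
        - c₁ * c₂ * c₃ * Fintype.card n := by
  simp only [Matrix.sub_mul, Matrix.mul_sub, Matrix.smul_mul, Matrix.mul_smul, Matrix.one_mul,
    Matrix.mul_one, smul_sub, smul_smul, Matrix.trace_sub, Matrix.trace_smul, Matrix.trace_one,
    smul_eq_mul, h123, h₁, h₂, h₃]
  ring

/-- **The massive odd ring of `d = 4`.**  For symmetric `h₁ h₂ h₃` (propagator Hessians at the three sides of
the triangle, traces `tr hᵢ = ΔD(xᵢ)` = the mass insertions) the odd ring is
`−½·[tr h₃·tr K(h₁⁰)K(h₂⁰) + tr h₂·tr K(h₁⁰)K(h₃⁰) + tr h₁·tr K(h₂⁰)K(h₃⁰)] − ¾·tr h₁ tr h₂ tr h₃`: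
no mass insertion, no skewness (`treeLevelSkewness_vanishes`); the third cumulant of a Gaussian `F²` in four
dimensions is carried entirely by the Laplacian of the propagator. [folklore] -/
theorem massiveOddRing_eq (h₁ h₂ h₃ : Matrix (Fin 4) (Fin 4) ℝ)
    (hs₁ : h₁.IsSymm) (hs₂ : h₂.IsSymm) (hs₃ : h₃.IsSymm) :
    (K h₁ * K h₂ * K h₃).trace =
      -(1 / 2 : ℝ) * (h₃.trace * (K (tracelessPart h₁) * K (tracelessPart h₂)).trace
          + h₂.trace * (K (tracelessPart h₁) * K (tracelessPart h₃)).trace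
          + h₁.trace * (K (tracelessPart h₂) * K (tracelessPart h₃)).trace)
        - (3 / 4 : ℝ) * (h₁.trace * h₂.trace * h₃.trace) := by
  have h123 : (K (tracelessPart h₁) * K (tracelessPart h₂) * K (tracelessPart h₃)).trace = 0 :=
    treeLevelSkewness_vanishes _ _ _ (tracelessPart_isSymm hs₁) (tracelessPart_isSymm hs₂)
      (tracelessPart_isSymm hs₃) (tracelessPart_trace _) (tracelessPart_trace _) (tracelessPart_trace _)
  rw [K_eq_tracelessPart h₁, K_eq_tracelessPart h₂, K_eq_tracelessPart h₃,
    trace_triple_shift _ _ _ _ _ _ h123 (trace_K_tracelessPart _) (trace_K_tracelessPart _)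
      (trace_K_tracelessPart _), Fintype.card_fin]
  push_cast
  ring

/-! ## §3 Collinear configurations: the gapped Gaussian odd ring is strictly negative -/

/-- The rank-one projector `e₀e₀ᵀ` onto the axis direction. [folklore] -/
def P₀ : Matrix (Fin 4) (Fin 4) ℝ := fun i j => if i = 0 ∧ j = 0 then 1 else 0

/-- The Hessian of a radial kernel at a point of the `e₀`-axis: `α·𝟙 + γ·e₀e₀ᵀ`
(`α = 2φ'(t²)`, `γ = 4t²φ''(t²)` for `D = φ(|x|²)` at `x = t e₀`). [folklore] -/
def axisHess (α γ : ℝ) : Matrix (Fin 4) (Fin 4) ℝ := fun i j => α * δ i j + γ * P₀ i j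

/-- `axisHess` is symmetric. [folklore] -/
theorem axisHess_isSymm (α γ : ℝ) : (axisHess α γ).IsSymm :=
  Matrix.IsSymm.ext fun i j => by
    fin_cases i <;> fin_cases j <;> simp [axisHess, δ, P₀]

/-- `tr axisHess α γ = 4α + γ` (`= ΔD` at the point). [folklore] -/
theorem axisHess_trace (α γ : ℝ) : (axisHess α γ).trace = 4 * α + γ := by
  simp [Matrix.trace, Matrix.diag, Fin.sum_univ_four, axisHess, δ, P₀]
  ring

/-- On the axis `K` is DIAGONAL in the plane basis: `−(2α+γ)` on the electric planes `01, 02, 03` and `−2α`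
on the magnetic planes `12, 13, 23`. [folklore] -/
theorem K_axisHess (α γ : ℝ) :
    K (axisHess α γ) = Matrix.diagonal ![-(2 * α + γ), -(2 * α + γ), -(2 * α + γ), -2 * α, -2 * α, -2 * α] := by
  ext i j
  fin_cases i <;> fin_cases j <;>
    simp +decide [K, axisHess, P₀, δ, Matrix.diagonal] <;> ring

/-- **The collinear odd ring** `tr K₁K₂K₃ = −3·[(2α₁+γ₁)(2α₂+γ₂)(2α₃+γ₃) + 8α₁α₂α₃]`. [folklore] -/
theorem axisOddRing_eq (α₁ γ₁ α₂ γ₂ α₃ γ₃ : ℝ) :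
    (K (axisHess α₁ γ₁) * K (axisHess α₂ γ₂) * K (axisHess α₃ γ₃)).trace =
      -3 * ((2 * α₁ + γ₁) * (2 * α₂ + γ₂) * (2 * α₃ + γ₃) + 8 * (α₁ * α₂ * α₃)) := by
  rw [K_axisHess, K_axisHess, K_axisHess, Matrix.diagonal_mul_diagonal, Matrix.diagonal_mul_diagonal,
    Matrix.trace_diagonal]
  simp [Fin.sum_univ_succ]
  ring

/-- **The collinear even ring** `tr K₁K₂ = 3(2α₁+γ₁)(2α₂+γ₂) + 12α₁α₂` (the normalisation `T`). [folklore] -/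
theorem axisEvenRing_eq (α₁ γ₁ α₂ γ₂ : ℝ) :
    (K (axisHess α₁ γ₁) * K (axisHess α₂ γ₂)).trace =
      3 * ((2 * α₁ + γ₁) * (2 * α₂ + γ₂)) + 12 * (α₁ * α₂) := by
  rw [K_axisHess, K_axisHess, Matrix.diagonal_mul_diagonal, Matrix.trace_diagonal]
  simp [Fin.sum_univ_succ]
  ring

/-- Harmonic kernels (`ΔDᵢ = 4αᵢ + γᵢ = 0`, the massless case) have vanishing collinear odd ring — the axis
instance of `treeLevelSkewness_vanishes`. [folklore] -/
theorem axisOddRing_eq_zero_of_harmonic {α₁ γ₁ α₂ γ₂ α₃ γ₃ : ℝ}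
    (ht₁ : 4 * α₁ + γ₁ = 0) (ht₂ : 4 * α₂ + γ₂ = 0) (ht₃ : 4 * α₃ + γ₃ = 0) :
    (K (axisHess α₁ γ₁) * K (axisHess α₂ γ₂) * K (axisHess α₃ γ₃)).trace = 0 := by
  rw [axisOddRing_eq]
  have e₁ : γ₁ = -4 * α₁ := by linarith
  have e₂ : γ₂ = -4 * α₂ := by linarith
  have e₃ : γ₃ = -4 * α₃ := by linarith
  subst e₁ e₂ e₃
  ring

/-- **THE MASSIVE GAUSSIAN FOIL.**  If at the three collinear separations the kernel is radially non-increasing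
(`αᵢ = 2φ' ≤ 0`) and strictly subharmonic (`ΔDᵢ = 4αᵢ + γᵢ > 0`: non-zero Källén–Lehmann mass, e.g. the free
massive propagator with `ΔD_m = m²D_m > 0`), the odd ring — `⅛` of the third-cumulant density of the Gaussian
Wick square `F_{μν}F_{μν}` — is STRICTLY NEGATIVE: with `uᵢ = −2αᵢ ≥ 0` it equals
`−3·[∏(ΔDᵢ + uᵢ) − ∏uᵢ] < 0`.  A gapped Gaussian `tr F²` has non-vanishing, sign-definite skewness at the
scale of the gap: the K2-analogue fails in the gapped Gaussian model. [folklore] -/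
theorem axisOddRing_neg {α₁ γ₁ α₂ γ₂ α₃ γ₃ : ℝ} (hα₁ : α₁ ≤ 0) (hα₂ : α₂ ≤ 0) (hα₃ : α₃ ≤ 0)
    (ht₁ : 0 < 4 * α₁ + γ₁) (ht₂ : 0 < 4 * α₂ + γ₂) (ht₃ : 0 < 4 * α₃ + γ₃) :
    (K (axisHess α₁ γ₁) * K (axisHess α₂ γ₂) * K (axisHess α₃ γ₃)).trace < 0 := by
  rw [axisOddRing_eq]
  -- mass variables `tᵢ = 4αᵢ + γᵢ > 0`, `uᵢ = −2αᵢ ≥ 0`; `2αᵢ + γᵢ = tᵢ + uᵢ`, `8α₁α₂α₃ = −u₁u₂u₃`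
  have hu₁ : 0 ≤ -2 * α₁ := by linarith
  have hu₂ : 0 ≤ -2 * α₂ := by linarith
  have hu₃ : 0 ≤ -2 * α₃ := by linarith
  have key : (2 * α₁ + γ₁) * (2 * α₂ + γ₂) * (2 * α₃ + γ₃) + 8 * (α₁ * α₂ * α₃)
      = (4 * α₁ + γ₁) * (4 * α₂ + γ₂) * (4 * α₃ + γ₃)
        + (4 * α₁ + γ₁) * (4 * α₂ + γ₂) * (-2 * α₃) + (4 * α₁ + γ₁) * (-2 * α₂) * (4 * α₃ + γ₃)
        + (-2 * α₁) * (4 * α₂ + γ₂) * (4 * α₃ + γ₃)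
        + (4 * α₁ + γ₁) * (-2 * α₂) * (-2 * α₃) + (-2 * α₁) * (4 * α₂ + γ₂) * (-2 * α₃)
        + (-2 * α₁) * (-2 * α₂) * (4 * α₃ + γ₃) := by
    ring
  have p₀ : 0 < (4 * α₁ + γ₁) * (4 * α₂ + γ₂) * (4 * α₃ + γ₃) := mul_pos (mul_pos ht₁ ht₂) ht₃
  have p₁ : 0 ≤ (4 * α₁ + γ₁) * (4 * α₂ + γ₂) * (-2 * α₃) := mul_nonneg (mul_nonneg ht₁.le ht₂.le) hu₃
  have p₂ : 0 ≤ (4 * α₁ + γ₁) * (-2 * α₂) * (4 * α₃ + γ₃) := mul_nonneg (mul_nonneg ht₁.le hu₂) ht₃.le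
  have p₃ : 0 ≤ (-2 * α₁) * (4 * α₂ + γ₂) * (4 * α₃ + γ₃) := mul_nonneg (mul_nonneg hu₁ ht₂.le) ht₃.le
  have p₄ : 0 ≤ (4 * α₁ + γ₁) * (-2 * α₂) * (-2 * α₃) := mul_nonneg (mul_nonneg ht₁.le hu₂) hu₃
  have p₅ : 0 ≤ (-2 * α₁) * (4 * α₂ + γ₂) * (-2 * α₃) := mul_nonneg (mul_nonneg hu₁ ht₂.le) hu₃
  have p₆ : 0 ≤ (-2 * α₁) * (-2 * α₂) * (4 * α₃ + γ₃) := mul_nonneg (mul_nonneg hu₁ hu₂) ht₃.le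
  nlinarith [key, p₀, p₁, p₂, p₃, p₄, p₅, p₆]

/-- Under the same signs the collinear EVEN ring is strictly positive (the self-normalisation `T^{3/2}` is
finite and non-zero, so the sign of the odd ring is the sign of the Gaussian self-normalised skewness).
[folklore] -/
theorem axisEvenRing_pos {α₁ γ₁ α₂ γ₂ : ℝ} (hα₁ : α₁ ≤ 0) (hα₂ : α₂ ≤ 0)
    (ht₁ : 0 < 4 * α₁ + γ₁) (ht₂ : 0 < 4 * α₂ + γ₂) :
    0 < (K (axisHess α₁ γ₁) * K (axisHess α₂ γ₂)).trace := by
  rw [axisEvenRing_eq]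
  have hu₁ : 0 ≤ -2 * α₁ := by linarith
  have hu₂ : 0 ≤ -2 * α₂ := by linarith
  have key : 3 * ((2 * α₁ + γ₁) * (2 * α₂ + γ₂)) + 12 * (α₁ * α₂)
      = 3 * ((4 * α₁ + γ₁) * (4 * α₂ + γ₂)) + 3 * ((4 * α₁ + γ₁) * (-2 * α₂))
        + 3 * ((-2 * α₁) * (4 * α₂ + γ₂)) + 6 * ((-2 * α₁) * (-2 * α₂)) := by
    ring
  have p₀ : 0 < (4 * α₁ + γ₁) * (4 * α₂ + γ₂) := mul_pos ht₁ ht₂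
  have p₁ : 0 ≤ (4 * α₁ + γ₁) * (-2 * α₂) := mul_nonneg ht₁.le hu₂
  have p₂ : 0 ≤ (-2 * α₁) * (4 * α₂ + γ₂) := mul_nonneg hu₁ ht₂.le
  have p₃ : 0 ≤ (-2 * α₁) * (-2 * α₂) := mul_nonneg hu₁ hu₂
  nlinarith [key, p₀, p₁, p₂, p₃]

/-- `|x|²` of a coordinate vector of `ℝ⁴` (the argument of the radial profiles). [folklore] -/
def normSq (x : Fin 4 → ℝ) : ℝ := ∑ i, x i ^ 2

/-- The point `t·e₀` of the axis, as a coordinate vector. [folklore] -/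
def axisVec (t : ℝ) : Fin 4 → ℝ := fun i => if i = 0 then t else 0

/-- `|t e₀|² = t²`. [folklore] -/
theorem normSq_axisVec (t : ℝ) : normSq (axisVec t) = t ^ 2 := by
  simp [normSq, axisVec]

/-- The Hessian of a radial kernel `D(x) = φ(|x|²)` on `ℝ⁴`: `∂_μ∂_ρD = a(|x|²)δ_{μρ} + b(|x|²)x_μx_ρ` with the two
radial profiles `a = 2φ'`, `b = 4φ''` taken as data (no calculus is used in this file; apply it to the
coordinates `⇑x` of a point of `EuclideanSpace ℝ (Fin 4)`). [folklore] -/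
def radialHess (a b : ℝ → ℝ) (x : Fin 4 → ℝ) : Matrix (Fin 4) (Fin 4) ℝ := fun μ ρ =>
  a (normSq x) * δ μ ρ + b (normSq x) * x μ * x ρ

/-- `tr radialHess = 4a(|x|²) + b(|x|²)|x|²` — the Laplacian `ΔD(x) = 8φ' + 4|x|²φ''` of `d = 4`. [folklore] -/
theorem radialHess_trace (a b : ℝ → ℝ) (x : Fin 4 → ℝ) :
    (radialHess a b x).trace = 4 * a (normSq x) + b (normSq x) * normSq x := by
  simp only [Matrix.trace, Matrix.diag, radialHess, δ, if_true, normSq, Fin.sum_univ_four]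
  ring

/-- On the `e₀`-axis the radial Hessian is `axisHess (a(t²)) (b(t²)t²)`. [folklore] -/
theorem radialHess_axis (a b : ℝ → ℝ) (t : ℝ) :
    radialHess a b (axisVec t) = axisHess (a (t ^ 2)) (b (t ^ 2) * t ^ 2) := by
  ext μ ρ
  simp only [radialHess, axisHess, normSq_axisVec, P₀, δ]
  fin_cases μ <;> fin_cases ρ <;> simp [axisVec, pow_two]
  ring

/-- **The foil in position language.**  For a radial Gaussian 2-form covariance `K(∇∇D)`, `D = φ(|x|²)`, and
three collinear separations `t₁e₀, t₂e₀, t₃e₀` (points `x, y, z` on a line, `t₃ = −t₁−t₂`) at which `D` is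
radially non-increasing (`a(tᵢ²) = 2φ'(tᵢ²) ≤ 0`) and strictly subharmonic
(`ΔD = 4a(tᵢ²) + b(tᵢ²)tᵢ² > 0`), the odd ring `tr G(x−y)G(y−z)G(z−x)` is strictly negative.  For the free
massive (Proca ∕ Källén–Lehmann-massive `dA`) field both conditions hold at every `tᵢ ≠ 0`, so the Gaussian
third cumulant of `F²` is negative on the whole collinear locus: the K2-analogue («gapped ⇒ no skewness») is
false in the gapped Gaussian model, while the massless model (`maxwellOddRing_eq_zero`) has no gap. [folklore] -/
theorem radialOddRing_collinear_neg (a b : ℝ → ℝ) (t₁ t₂ t₃ : ℝ)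
    (ha₁ : a (t₁ ^ 2) ≤ 0) (ha₂ : a (t₂ ^ 2) ≤ 0) (ha₃ : a (t₃ ^ 2) ≤ 0)
    (hΔ₁ : 0 < 4 * a (t₁ ^ 2) + b (t₁ ^ 2) * t₁ ^ 2) (hΔ₂ : 0 < 4 * a (t₂ ^ 2) + b (t₂ ^ 2) * t₂ ^ 2)
    (hΔ₃ : 0 < 4 * a (t₃ ^ 2) + b (t₃ ^ 2) * t₃ ^ 2) :
    (K (radialHess a b (axisVec t₁)) * K (radialHess a b (axisVec t₂)) *
        K (radialHess a b (axisVec t₃))).trace < 0 := by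
  rw [radialHess_axis, radialHess_axis, radialHess_axis]
  exact axisOddRing_neg ha₁ ha₂ ha₃ hΔ₁ hΔ₂ hΔ₃

end Summit.QuantumFields.YangMills.Theorems.SkewnessNonGeneration.Negative.MassiveGaussianFoil

end
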